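import Summits.BirchSwinnertonDyer.Rank1Residual.SecondDescent.BSDpFromSecondDescentEmpty
import Summits.BirchSwinnertonDyer.Rank1Residual.X11b.ChaPairsMinimality
import HarnessLib

/-!
# B-1 second-3-descent `EMPTY` RECORDS, `p = 3`, analytic rank zero — batch 01: Fisher–Newton's curve `17127b1` (cell `b2b-bsdres`, CLASS-CLOSURE instrument seat cc-eng-4, GEN 6)

HONEST FRAMING (run/shared/lean/b2b/bsd-rank1-residual/, verbatim in every file): the goal of the
cell is to DELETE the COMBINATION-SHAPED residual classes of the Birch–Swinnerton-Dyer formula for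
ALL analytic-rank `≤ 1` elliptic curves over `ℚ` — "full BSD formula for every rank `≤ 1` curve in
class `C`" assembled STRICTLY from published theorems — so that the rank-`≤ 1` remainder becomes
exactly the CONSTRUCTION-SHAPED classes, which are TYPED (missing-input `Prop`s), NOT attempted.
This is not "finishing BSD". Class X4 (additive at `p`) stays CONSTRUCTION-SHAPED; everything here is
PER PAIR; per-curve second-descent outputs are INSTRUMENTATION (class-closure E4) / EVIDENCE under
census-lead's tier label; no lane verdict is changed; no named fact is added; nothing is booked by
this unit (the lane books, referee A's rules).

Theorems only (no definition, no `sorry`). **What this file records.** The B-1 instrument's `EMPTY`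
reading (`SecondDescent/BSDpFromSecondDescentEmpty.lean`, p288200: Gross–Zagier–Kolyvagin `hGZK` +
the Cassels–Tate pairing fact `hCT` + `E[3]` irreducible + `#Sel^(3)(E/ℚ) = 9` EXACT + ONE `3`-torsion
class of `Ш(E/ℚ)` that is NOT a third multiple in `Ш` + `ord₃ #Ш_an = 2` ⟹ `BSD(E,3)`, because then
`Ш[9] = Ш[3] ≅ (ℤ/3)²`, so `#Ш[3^∞] = 9 = 3^{ord₃ #Ш_an}` — NO upper-bound theorem, no main
conjecture, no Kurihara number) as
* `bsdp_three_rankZero_of_ainvs_of_card_selmerThree_eq_nine_of_casselsTate_of_not_divisible` — the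
  certificate shape for a LITERAL integer model `⟨a₁,a₂,a₃,a₄,a₆⟩` (`Δ ≠ 0` by `decide`, as in
  `X11b/ShapiroPairs.lean`), all arithmetic inputs as binders;
* `bsdp3_b1e_17127b1` — the record for `17127b1 = [1,-1,1,-19163564,-34134737802]`
  (`N = 17127 = 3²·11·173`, additive (type IV) at `3`, `ρ̄_{E,3}` surjective, `r_an = 0`, `#E(ℚ)_tors
  = 2`, `∏ c_ℓ = 12`, `#Ш_an = 9`): a sha-2-census RESISTANT T-full3 pair (additive `3` with
  `3 ∣ ∏ c_ℓ`: Wuthrich's Prop. 21 excludes additive `p`, and the Kato / Kolyvagin squeezes of sha-2's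
  rules V9/V12 lose the Tamagawa factor) whose binders ALL have evidence on file, most of it twice:
  - `h3 : #Sel^(3)(E/ℚ) = 9` — Fisher–Newton p. 16 ("`S^{(3)}(E/ℚ) ≅ (ℤ/3ℤ)²` generated by `α, γ`")
    AND the cell's EXACT `3`-descent of record (x11b `desc3lib.gp` `EXACT(bnfcertify1+3sat)`, sha-2
    GEN-1 kit j066277, `S = {3, 11, 173}`, `Cl(A) = 1`; x11b `verify3` ALL-CHECKS-PASS; sha-2's
    independent element-level verifier `sel3chk.gp` v1.1, kit j110592, PASS) — two implementations;
  - `c, h3c, hndiv` (a `3`-torsion class of `Ш` not divisible by `3`) — Fisher–Newton p. 17 ll. 62–70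
    (the Cassels–Tate pairing on `S^{(3)}(E/ℚ)` is NON-ZERO, hence non-degenerate, hence NO element of
    `Ш(E)[3]` is divisible by `3` and `Ш(E)[3^∞] ≅ (ℤ/3ℤ)²`) AND the B-1 instrument's STEP-0 control
    S0-CT3 Q1 (`class-closure/eng-4/step0/S0-CT3-REPORT.md`: the algebraic `3`-Selmer SET of FN's
    plane cubic `C₁` — and of `C₃` and of the pipeline's own cubics `η₁, η₂` — is EMPTY in EXACT mode,
    engine 1 `creutz3.gp` with `bnfcertify(F,1) = 1` + `3`-saturation, engine 2 agreeing (Q5); Creutz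
    2014: `Sel^{(3)}(C/ℚ) = ∅ ⟺ [C] ∉ 3·Sel^{(9)}(E/ℚ)`, and at rank `0` with `3 ∤ #E(ℚ)_tors` this is
    `[C] ∉ 3·Ш`);
  - `hs, hv : ord₃ #Ш_an = 2` — Cremona's `allbsd` (`#Ш_an = 9.000…`), Fisher–Newton p. 16;
  - `hr : r_an = 0`, `hirr` (`ρ̄_{E,3}` onto `GL₂(𝔽₃)`, Fisher–Newton p. 16; Cremona `galrep`: `2B` only).
  For THIS curve the conclusion is also Fisher–Newton's own (their §4 closes with `Ш[3^∞] ≅ (ℤ/3)²`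
  for `17127b1`); the record's value is the SHAPE every further B-1 `EMPTY` row will use (the seven
  remaining sha-2-RESISTANT T-full3 window rows at `p = 3`: `class-closure/eng-4/b1/production-staged-g6/README.md`).
Non-kernel inputs per pair (binders, EVIDENCE): `r_an = 0`, `irr(3)`, `#Sel^(3) = 9`, the `EMPTY` class,
`#Ш_an`. Kernel: `Δ ≠ 0`. Named facts consumed: `rank_eq_analyticRank_of_analyticRank_le_one` (GZK),
`exists_casselsTate_pairing` (Cassels 1962 / Silverman X.4.14) — both already inputs of this
directory's other consumers.

References: T. Fisher, R. Newton, "Computing the Cassels–Tate pairing on the 3-Selmer group of an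
elliptic curve", Int. J. Number Theory 10 (2014) = arXiv:1306.1410, §4 [FisherNewton2014];
B. Creutz, "Second p-descents on elliptic curves", Math. Comp. 83 (2014) 365–409, §§5–8
[Creutz2014]; J. W. S. Cassels, J. reine angew. Math. 211 (1962) [Cassels1962ArithmeticIV];
J. H. Silverman, *AEC* 2nd ed., X.4 [SilvermanAEC2009]; R. L. Miller, LMS JCM 14 (2011) §1
[Miller2011LMS]; J. E. Cremona's tables [Cremona2006].
-/

set_option autoImplicit false

noncomputable section

open scoped Classical

open WeierstrassCurve Literature.NumberTheory.EllipticCurves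
  Literature.NumberTheory.EllipticCurves.Rank1Residual
  Literature.NumberTheory.EllipticCurves.Rank1Residual.Typed
  Literature.NumberTheory.EllipticCurves.Rank1Residual.X11RankOneCertificates
  Summit.BirchSwinnertonDyer.Rank1Residual.X11b

namespace Summit.BirchSwinnertonDyer.Rank1Residual.SecondDescent

/-! ### §1. The certificate shape for a literal integer model -/

/-- **B-1 `EMPTY` reading for a literal model, analytic rank `0`, `p = 3`.** For integers
`a₁,…,a₆` with `discOf [a₁,…,a₆] ≠ 0` (so `⟨a₁,…,a₆⟩` is an elliptic curve over `ℚ`,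
`isElliptic_of_discOf_ne_zero`): GZK + the Cassels–Tate pairing fact + `r_an = 0` + `E[3]` irreducible
+ `#Sel^(3)(E/ℚ) = 9` + ONE class `c ∈ Ш(E/ℚ)` with `3•c = 0` that is not a third multiple in `Ш`
+ `#Ш_an = s` with `ord₃ s = 2` ⟹ `BSD(E,3)`. This is
`bsdp_three_rankZero_of_card_selmerThree_eq_nine_of_casselsTate_of_not_divisible` (p288200) with the
`IsElliptic` instance manufactured from the literal discriminant. Per pair; nothing booked.
[cite: SilvermanAEC2009, Thm. X.4.2(a) and Thm. X.4.14] [cite: Creutz2014, §1]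
[cite: Miller2011LMS, §1 and Def. 1.1] -/
theorem bsdp_three_rankZero_of_ainvs_of_card_selmerThree_eq_nine_of_casselsTate_of_not_divisible
    (hGZK : rank_eq_analyticRank_of_analyticRank_le_one)
    (hCT : exists_casselsTate_pairing (K := ℚ))
    (a1 a2 a3 a4 a6 : ℤ) (hΔ : discOf [a1, a2, a3, a4, a6] ≠ 0)
    (hr : (⟨a1, a2, a3, a4, a6⟩ : WeierstrassCurve ℚ).analyticRank = 0)
    (hirr : Irr (⟨a1, a2, a3, a4, a6⟩ : WeierstrassCurve ℚ) 3)
    (h3 : Nat.card ((⟨a1, a2, a3, a4, a6⟩ : WeierstrassCurve ℚ).selmerGroup (3 : ℤ)) = 9)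
    {c : (⟨a1, a2, a3, a4, a6⟩ : WeierstrassCurve ℚ).sha} (h3c : 3 • c = 0)
    (hndiv : ∀ d : (⟨a1, a2, a3, a4, a6⟩ : WeierstrassCurve ℚ).sha, 3 • d ≠ c)
    {s : ℚ} (hs : shaAn (⟨a1, a2, a3, a4, a6⟩ : WeierstrassCurve ℚ) = (s : ℂ))
    (hv : padicValRat 3 s = 2) :
    BSDp (⟨a1, a2, a3, a4, a6⟩ : WeierstrassCurve ℚ) 3 := by
  haveI := isElliptic_of_discOf_ne_zero a1 a2 a3 a4 a6 hΔ
  exact bsdp_three_rankZero_of_card_selmerThree_eq_nine_of_casselsTate_of_not_divisible hGZK hCT _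
    hr hirr h3 h3c hndiv hs hv

/-! ### §2. Batch 01 — the published control curve of the instrument -/

/-- **`BSD(E,3)` for `17127b1`** [EXACT; the B-1 `EMPTY` record shape] (`N = 17127 = 3²·11·173`,
additive (Kodaira type IV) at `3`; Cremona model `[1,-1,1,-19163564,-34134737802]`; `ρ̄_{E,3}`
surjective; `r_an = 0`; `#E(ℚ)_tors = 2`; `∏ c_ℓ = 12`; `#Ш_an = 9`; sha-2 odd-p Ш census: T-full3,
RESISTANT to every squeeze in print — additive `3` with `3 ∣ ∏ c_ℓ`) from GZK, the Cassels–Tate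
pairing fact, and the per-pair certificate lines: `#Sel^(3)(E/ℚ) = 9` EXACT (Fisher–Newton p. 16
`S^{(3)} ≅ (ℤ/3)²`; x11b `desc3lib` `EXACT(bnfcertify1+3sat)` kit j066277 with `S = {3,11,173}`,
`Cl(A) = 1`, verify3 ALL-CHECKS-PASS; sha-2 `sel3chk` v1.1 kit j110592 PASS — two implementations);
ONE class of `Ш(E)[3]` not divisible by `3`: the class of Fisher–Newton's plane cubic `C₁` (FN p. 17
ll. 62–70: the Cassels–Tate pairing on `S^{(3)}` is non-zero, so no element of `Ш(E)[3]` is a third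
multiple; independently the B-1 second `3`-descent of record, S0-CT3 Q1: `Sel_alg^{(3)}(C₁/ℚ) = ∅`
EXACT, engine 1 `creutz3.gp` `bnfcertify + 3-sat`, engine 2 agreeing); `#Ш_an = 9` (Cremona). Hence
`Ш(E)[9] = Ш(E)[3]`, `#Ш(E)[3^∞] = 9 = 3^{ord₃ #Ш_an}`: `BSD(E,3)` with NO upper-bound input.
Kernel: `Δ ≠ 0`. Binders (EVIDENCE, per pair): `hr`, `hirr`, `h3`, `c/h3c/hndiv`, `hs/hv`;
named facts: `hGZK`, `hCT`. Per pair; class X4 unchanged; nothing booked.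
[cite: FisherNewton2014, §4 (pp. 16–17)] [cite: Creutz2014, §1 and §7]
[cite: SilvermanAEC2009, Thm. X.4.2(a) and Thm. X.4.14] [cite: Miller2011LMS, §1 and Def. 1.1]
[cite: Cremona2006, Table 1 (Cremona label 17127b1)] -/
theorem bsdp3_b1e_17127b1 (hGZK : rank_eq_analyticRank_of_analyticRank_le_one)
    (hCT : exists_casselsTate_pairing (K := ℚ))
    (W : WeierstrassCurve ℚ) (hW : W = ⟨1, -1, 1, -19163564, -34134737802⟩)
    (hr : W.analyticRank = 0) (hirr : Irr W 3)
    (h3 : Nat.card (W.selmerGroup (3 : ℤ)) = 9)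
    {c : W.sha} (h3c : 3 • c = 0) (hndiv : ∀ d : W.sha, 3 • d ≠ c)
    {s : ℚ} (hs : shaAn W = (s : ℂ)) (hv : padicValRat 3 s = 2) : BSDp W 3 := by
  subst hW
  exact bsdp_three_rankZero_of_ainvs_of_card_selmerThree_eq_nine_of_casselsTate_of_not_divisible
    hGZK hCT 1 (-1) 1 (-19163564) (-34134737802) (by decide +kernel) hr hirr h3 h3c hndiv hs hv

/-! ### §3. The certificate shape for a literal model at ANY analytic rank `≤ 1` and any prime (APPEND, cc-eng-4 GEN 6) -/

/-- **B-1 `EMPTY` reading for a literal model, analytic rank `≤ 1`, any prime `p`.** For integers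
`a₁,…,a₆` with `discOf [a₁,…,a₆] ≠ 0`: GZK + the Cassels–Tate pairing fact + `r_an ≤ 1` + `E[p]`
irreducible + `#Sel^(p)(E/ℚ) = p^(r_an + 2)` + ONE class `c ∈ Ш(E/ℚ)` with `p•c = 0` that is not a
`p`-th multiple in `Ш` + `#Ш_an = q` with `ord_p q = 2` ⟹ `BSD(E,p)`. This is
`bsdp_of_irr_of_card_selmer_of_casselsTate_of_not_divisible` (p288200) with the `IsElliptic`
instance manufactured from the literal discriminant; it is the record shape for the rank-ONE
`EMPTY`-direction rows (X11b@3 seven, additive-p3 R1-SHA2 57: `#Sel^(3) = 27`) as well as for the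
rank-zero rows of §1 (`#Sel^(3) = 9`). Per pair; nothing booked.
[cite: Mazur1977, Ch. III §5, p. 157] [cite: SilvermanAEC2009, Thm. X.4.2(a) and Thm. X.4.14]
[cite: Creutz2014, §1] [cite: Miller2011LMS, §1 and Def. 1.1] -/
theorem bsdp_of_ainvs_of_irr_of_card_selmer_of_casselsTate_of_not_divisible
    (hGZK : rank_eq_analyticRank_of_analyticRank_le_one)
    (hCT : exists_casselsTate_pairing (K := ℚ))
    (a1 a2 a3 a4 a6 : ℤ) (hΔ : discOf [a1, a2, a3, a4, a6] ≠ 0) (p : ℕ) [Fact p.Prime]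
    (hr : (⟨a1, a2, a3, a4, a6⟩ : WeierstrassCurve ℚ).analyticRank ≤ 1)
    (hirr : Irr (⟨a1, a2, a3, a4, a6⟩ : WeierstrassCurve ℚ) p)
    (hSel : Nat.card ((⟨a1, a2, a3, a4, a6⟩ : WeierstrassCurve ℚ).selmerGroup (p : ℤ)) =
      p ^ ((⟨a1, a2, a3, a4, a6⟩ : WeierstrassCurve ℚ).analyticRank + 2))
    {c : (⟨a1, a2, a3, a4, a6⟩ : WeierstrassCurve ℚ).sha} (hpc : p • c = 0)
    (hndiv : ∀ d : (⟨a1, a2, a3, a4, a6⟩ : WeierstrassCurve ℚ).sha, p • d ≠ c)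
    {q : ℚ} (hq : shaAn (⟨a1, a2, a3, a4, a6⟩ : WeierstrassCurve ℚ) = (q : ℂ))
    (hv : padicValRat p q = 2) :
    BSDp (⟨a1, a2, a3, a4, a6⟩ : WeierstrassCurve ℚ) p := by
  haveI := isElliptic_of_discOf_ne_zero a1 a2 a3 a4 a6 hΔ
  exact bsdp_of_irr_of_card_selmer_of_casselsTate_of_not_divisible _ p hGZK hCT hr hirr hSel hpc
    hndiv hq hv

end Summit.BirchSwinnertonDyer.Rank1Residual.SecondDescent

end
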